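import Literature.AlgebraicGeometry.Morphisms.FormalModulePowerTorsion
import Literature.AlgebraicGeometry.Morphisms.FormalModuleIdealQuot
import Literature.AlgebraicGeometry.Modules.SectionsExact
import HarnessLib

/-!
# Grothendieck's existence theorem: formal towers killed by `(a)ᶜ·𝒥ᵉ`

The Stacks Project, Tag 088A / Tag 088C (Cohomology of Schemes, Lemma 30.27.3 and the proper case
of Grothendieck's existence theorem); Görtz–Wedhorn, *Algebraic Geometry II* (2023), §(24.21),
Lemma 24.105 / Lemma 24.106. In the noetherian induction proving the existence theorem for a
PROPER `X → Spec A` (`A` noetherian and `a`-adically complete), the comparison morphism from a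
coherent formal module `𝓕` to an algebraizable one obtained from a Chow cover (the unit
`𝓕 → ρ_*ρ^*𝓕` composed with a quasi-inverse of the `a`-power isogeny `(ρ_*𝒢')^ → ρ_*(𝒢'^)` of
the theorem on formal functions) has levelwise kernels and cokernels killed by a MIXED ideal
`(a)ᶜ·𝒥ᵈ`, `𝒥` an ideal of definition of the exceptional locus. The tricky lemma of the tree
(`Morphisms/FormalModuleTricky.exists_coh_iso_of_torsion_kernel_cokernel`) then asks for the
algebraizability of all coherent formal towers killed by `𝒦 + ((a)·𝒥)ᵉ = 𝒦 + (a)ᵉ·𝒥ᵉ`, whereas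
the induction hypothesis only provides it for towers killed by `𝒦 + 𝒥ᵉ` (towers "on the closed
subscheme `V(𝒦 + 𝒥ᵉ)`"). This file closes that gap:

* `isKilledBy_pow_ofIdealTop_kernel_of_fac` — if `(a)ᶜ·𝒥` kills an affine-localizing `M`, then
  `(a)ᶜ` kills the kernel of `M → M/𝒥M` (followed by any monomorphism);
* `exists_coh_iso_cmplTower_of_isKilledBy_pow_mul` — **a coherent formal tower `𝓕` along `a` on
  `X` proper over the `a`-adically complete noetherian `A`, killed by `𝒦` and by `(a)ᶜ·𝒥ᵉ`, is the
  completion tower of a coherent `𝒪_X`-module as soon as every coherent formal tower killed by `𝒦`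
  and by `𝒥ᵉ` is**: the quotient tower `(𝓕_n/𝒥ᵉ𝓕_n)_n` (`Morphisms/FormalModuleIdealQuot`) is
  algebraizable by hypothesis, `≅ H^`, and `𝓕 → 𝓕/𝒥ᵉ ≅ H^` is a levelwise epimorphism whose
  levelwise kernels `𝒥ᵉ𝓕_n` are killed by `aᶜ`, so the tricky lemma along `(a)`
  (`Morphisms/FormalModulePowerTorsion.exists_coh_iso_cmplTower_of_powTorsion_comparison`) applies;
* `exists_coh_iso_cmplTower_of_isKilledBy_mul_pow` — the same with the hypothesis phrased for
  `((a)·𝒥)ᵉ`, the shape produced by the tricky lemma.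

Everything is proved; no named facts; no definitions.

## References

* The Stacks Project, Tag 088A (Lemma 30.27.3), Tag 088C. [StacksProject]
* U. Görtz, T. Wedhorn, *Algebraic Geometry II: Cohomology of Schemes*, Springer Spektrum (2023),
  doi:10.1007/978-3-658-43031-3: Lemma 24.105, Lemma 24.106 (pp. 573–575). [GortzWedhorn2023]
-/

noncomputable section

-- `TopCat.Presheaf`/`Scheme.Modules` are not reducible (as in Mathlib's `AlgebraicGeometry/Modules`).
set_option backward.isDefEq.respectTransparency false

open CategoryTheory AlgebraicGeometry Limits TopologicalSpace Opposite
open Literature.AlgebraicGeometry.Modules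

universe u

namespace Literature.AlgebraicGeometry.Morphisms

/-! ### The kernel of `M → M/𝒥M` for a module killed by `(a)ᶜ·𝒥` -/

section Killed

variable {X : Scheme.{u}} (a : Γ(X, ⊤))

/-- The ideal of the affine open `V` attached to `(a)ᶜ` is generated by `aᶜ|_V`. [folklore] -/
private theorem ideal_pow_ofIdealTop_span' (c : ℕ) (V : X.affineOpens) :
    (Scheme.IdealSheafData.ofIdealTop (Ideal.span {a}) ^ c).ideal V =
      Ideal.span {X.presheaf.map (homOfLE (le_top : (V : X.Opens) ≤ ⊤)).op (a ^ c)} := by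
  rw [Scheme.IdealSheafData.ideal_pow, Pi.pow_apply, Scheme.IdealSheafData.ofIdealTop_ideal,
    Ideal.map_span, Set.image_singleton, Ideal.span_singleton_pow, map_pow]

/-- **If `(a)ᶜ·𝒥` kills `M` then `aᶜ|_V · (𝒥(V)·Γ(V, M)) = 0`** on every affine open `V`. [folklore] -/
private theorem pow_smul_eq_zero_of_mem_ideal_smul_top {J : X.IdealSheafData} {M : X.Modules} {c : ℕ}
    (hM : IsKilledBy (Scheme.IdealSheafData.ofIdealTop (Ideal.span {a}) ^ c * J) M)
    (V : X.affineOpens) {m : Γ(M, V)}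
    (hm : m ∈ J.ideal V • (⊤ : Submodule Γ(X, V) Γ(M, V))) :
    X.presheaf.map (homOfLE (le_top : (V : X.Opens) ≤ ⊤)).op (a ^ c) • m = 0 := by
  have hmem : X.presheaf.map (homOfLE (le_top : (V : X.Opens) ≤ ⊤)).op (a ^ c) • m ∈
      (Scheme.IdealSheafData.ofIdealTop (Ideal.span {a}) ^ c * J).ideal V •
        (⊤ : Submodule Γ(X, V) Γ(M, V)) := by
    rw [Scheme.IdealSheafData.ideal_mul, Pi.mul_apply, Submodule.mul_smul]
    refine Submodule.smul_mem_smul ?_ hm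
    rw [ideal_pow_ofIdealTop_span']
    exact Ideal.mem_span_singleton_self _
  rw [ideal_smul_top_eq_bot_of_isKilledBy hM V, Submodule.mem_bot] at hmem
  exact hmem

/-- **If `(a)ᶜ·𝒥` kills the affine-localizing module `M`, then `(a)ᶜ` kills the kernel of any
morphism `φ : M → N` which factors as `M → M/𝒥M` followed by a monomorphism** (e.g. `φ` = the
projection followed by an isomorphism): a section of the kernel over an affine `V` is a section of
`M` dying in `M/𝒥M`, i.e. an element of `𝒥(V)·Γ(V, M)` (`idealQuotπ_app_eq_zero_iff`).
[cite: StacksProject, Tag 088A] -/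
theorem isKilledBy_pow_ofIdealTop_kernel_of_fac {J : X.IdealSheafData} {M N : X.Modules} {c : ℕ}
    (hMloc : IsAffineLocalizing M)
    (hM : IsKilledBy (Scheme.IdealSheafData.ofIdealTop (Ideal.span {a}) ^ c * J) M)
    (φ : M ⟶ N) (ψ : idealQuot M J ⟶ N) [Mono ψ] (hfac : idealQuotπ M J ≫ ψ = φ) :
    IsKilledBy (Scheme.IdealSheafData.ofIdealTop (Ideal.span {a}) ^ c) (kernel φ) := by
  intro V r hr k
  rw [ideal_pow_ofIdealTop_span', Ideal.mem_span_singleton'] at hr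
  obtain ⟨s, rfl⟩ := hr
  apply kernel_ι_app_injective φ (V : X.Opens)
  rw [Scheme.Modules.Hom.app_smul, map_zero, mul_smul]
  -- the section `m = ι(k)` of `M` dies under `φ`, hence in `M/𝒥M`
  set m : Γ(M, V) := (kernel.ι φ).app (V : X.Opens) k with hm
  have hφm : φ.app (V : X.Opens) m = 0 := app_kernel_ι_app φ V k
  have hπm : (idealQuotπ M J).app (V : X.Opens) m = 0 := by
    apply KTheory.app_injective_of_mono ψ (V : X.Opens)
    rw [map_zero, ← CategoryTheory.comp_apply, ← Scheme.Modules.Hom.comp_app, hfac]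
    exact hφm
  have hmJ : m ∈ J.ideal V • (⊤ : Submodule Γ(X, V) Γ(M, V)) :=
    (idealQuotπ_app_eq_zero_iff J hMloc V.2 m).mp hπm
  rw [pow_smul_eq_zero_of_mem_ideal_smul_top a hM V hmJ, smul_zero]

end Killed

/-! ### Formal towers killed by `(a)ᶜ·𝒥ᵉ` -/

section Mixed

variable {A : Type u} [CommRing A] [IsNoetherianRing A] {X : Scheme.{u}} (f : X ⟶ Spec (.of A))
  [IsProper f] (a : A) [IsAdicComplete (Ideal.span {a}) A] [IsLocallyNoetherian X] [CompactSpace X]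

/-- **Formal towers killed by `𝒦` and `(a)ᶜ·𝒥ᵉ` are algebraizable if those killed by `𝒦` and `𝒥ᵉ`
are** (`X` proper over the `a`-adically complete noetherian `A`). The quotient tower
`(𝓕_n/𝒥ᵉ𝓕_n)_n` is a coherent formal tower killed by `𝒦` and `𝒥ᵉ`, hence `≅ H^` by hypothesis;
the levelwise epimorphism `𝓕 → 𝓕/𝒥ᵉ ≅ H^` has levelwise kernels `𝒥ᵉ𝓕_n`, killed by `aᶜ`, so the
tricky lemma along `(a)` applies (Stacks 088A with `𝒥 = (a)`: towers killed by a power of `a` are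
eventually constant). [cite: StacksProject, Tag 088A] [cite: StacksProject, Tag 088C]
[cite: GortzWedhorn2023, Lemma 24.105 and Lemma 24.106 (pp. 573–575)] -/
theorem exists_coh_iso_cmplTower_of_isKilledBy_pow_mul {K J : X.IdealSheafData} {e : ℕ}
    (IH : ∀ 𝓖 : ℕᵒᵖ ⥤ X.Modules, IsFormalTower (algebraMapΓ f a) 𝓖 → (∀ n, Coh (𝓖.obj ⟨n⟩)) →
      (∀ n, IsKilledBy K (𝓖.obj ⟨n⟩)) → (∀ n, IsKilledBy (J ^ e) (𝓖.obj ⟨n⟩)) →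
        ∃ G : X.Modules, Coh G ∧ Nonempty (𝓖 ≅ cmplTower (algebraMapΓ f a) G))
    {𝓕 : ℕᵒᵖ ⥤ X.Modules} (h𝓕 : IsFormalTower (algebraMapΓ f a) 𝓕) (h𝓕c : ∀ n, Coh (𝓕.obj ⟨n⟩))
    (h𝓕K : ∀ n, IsKilledBy K (𝓕.obj ⟨n⟩)) {c : ℕ}
    (h𝓕J : ∀ n, IsKilledBy
      (Scheme.IdealSheafData.ofIdealTop (Ideal.span {algebraMapΓ f a}) ^ c * J ^ e) (𝓕.obj ⟨n⟩)) :
    ∃ F : X.Modules, Coh F ∧ Nonempty (𝓕 ≅ cmplTower (algebraMapΓ f a) F) := by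
  -- the quotient tower `𝓖 = 𝓕/𝒥ᵉ` is algebraizable by hypothesis
  have h𝓖 : IsFormalTower (algebraMapΓ f a) (𝓕 ⋙ idealQuotFunctor (J ^ e)) :=
    h𝓕.comp_idealQuotFunctor (J ^ e)
  have h𝓖c : ∀ n, Coh ((𝓕 ⋙ idealQuotFunctor (J ^ e)).obj ⟨n⟩) :=
    coh_comp_idealQuotFunctor (J ^ e) h𝓕c
  have h𝓖K : ∀ n, IsKilledBy K ((𝓕 ⋙ idealQuotFunctor (J ^ e)).obj ⟨n⟩) := fun n =>
    IsKilledBy.of_epi (idealQuotπ (𝓕.obj ⟨n⟩) (J ^ e)) (h𝓕K n)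
  have h𝓖J : ∀ n, IsKilledBy (J ^ e) ((𝓕 ⋙ idealQuotFunctor (J ^ e)).obj ⟨n⟩) :=
    isKilledBy_comp_idealQuotFunctor (J ^ e) 𝓕
  obtain ⟨H, hH, ⟨ε⟩⟩ := IH _ h𝓖 h𝓖c h𝓖K h𝓖J
  -- the comparison `α : 𝓕 → 𝓕/𝒥ᵉ ≅ H^` (the levelwise projection is the whiskered natural
  -- transformation `𝟭 ⟶ (−/𝒥ᵉ)`)
  let α : 𝓕 ⟶ cmplTower (algebraMapΓ f a) H :=
    (Functor.rightUnitor 𝓕).inv ≫ Functor.whiskerLeft 𝓕 (idealQuotπNatTrans (J ^ e)) ≫ ε.hom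
  have hα : ∀ n : ℕᵒᵖ, α.app n = idealQuotπ (𝓕.obj n) (J ^ e) ≫ ε.hom.app n := fun n => by
    simp only [α, NatTrans.comp_app, Functor.whiskerLeft_app, Functor.rightUnitor_inv_app,
      Category.id_comp]
    rfl
  refine exists_coh_iso_cmplTower_of_powTorsion_comparison f a h𝓕 h𝓕c hH α (d := c)
    (fun n => ?_) (fun n => ?_)
  · -- the kernel `𝒥ᵉ𝓕_n` of `α_n` is killed by `aᶜ`
    have hk : IsKilledBy (Scheme.IdealSheafData.ofIdealTop (Ideal.span {algebraMapΓ f a}) ^ c)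
        (kernel (α.app ⟨n⟩)) := by
      rw [hα]
      exact isKilledBy_pow_ofIdealTop_kernel_of_fac (algebraMapΓ f a) (h𝓕c n).loc (h𝓕J n)
        _ (ε.hom.app ⟨n⟩) rfl
    rw [← globalScalar_comp, globalScalar_eq_zero_of_isKilledBy_pow_ofIdealTop _ hk, zero_comp]
  · -- `α_n` is an epimorphism
    haveI : Epi (α.app ⟨n⟩) := by rw [hα]; exact epi_comp _ _
    rw [cokernel.π_of_epi, comp_zero]

/-- **The same, with the hypothesis in the shape `((a)·𝒥)ᵉ`** delivered by the tricky lemma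
(`((a)·𝒥)ᵉ = (a)ᵉ·𝒥ᵉ`). [cite: StacksProject, Tag 088A] [cite: StacksProject, Tag 088C] -/
theorem exists_coh_iso_cmplTower_of_isKilledBy_mul_pow {K J : X.IdealSheafData} {e : ℕ}
    (IH : ∀ 𝓖 : ℕᵒᵖ ⥤ X.Modules, IsFormalTower (algebraMapΓ f a) 𝓖 → (∀ n, Coh (𝓖.obj ⟨n⟩)) →
      (∀ n, IsKilledBy K (𝓖.obj ⟨n⟩)) → (∀ n, IsKilledBy (J ^ e) (𝓖.obj ⟨n⟩)) →
        ∃ G : X.Modules, Coh G ∧ Nonempty (𝓖 ≅ cmplTower (algebraMapΓ f a) G))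
    {𝓕 : ℕᵒᵖ ⥤ X.Modules} (h𝓕 : IsFormalTower (algebraMapΓ f a) 𝓕) (h𝓕c : ∀ n, Coh (𝓕.obj ⟨n⟩))
    (h𝓕K : ∀ n, IsKilledBy K (𝓕.obj ⟨n⟩))
    (h𝓕J : ∀ n, IsKilledBy
      ((Scheme.IdealSheafData.ofIdealTop (Ideal.span {algebraMapΓ f a}) * J) ^ e) (𝓕.obj ⟨n⟩)) :
    ∃ F : X.Modules, Coh F ∧ Nonempty (𝓕 ≅ cmplTower (algebraMapΓ f a) F) :=
  exists_coh_iso_cmplTower_of_isKilledBy_pow_mul f a IH h𝓕 h𝓕c h𝓕K (c := e)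
    fun n => by rw [← mul_pow]; exact h𝓕J n

/-- **Induction-hypothesis form**: if, for every `e ≥ d`, all coherent formal towers killed by `𝒦`
and `𝒥ᵉ` are algebraizable, then so are, for every `e ≥ d`, all coherent formal towers killed by
`𝒦` and `((a)·𝒥)ᵉ` — exactly the hypothesis `IH` of the tree's tricky lemma
`exists_coh_iso_of_torsion_kernel_cokernel` for the ideal `(a)·𝒥`.
[cite: StacksProject, Tag 088A] [cite: StacksProject, Tag 088C] -/
theorem trickyIH_mul_ofIdealTop {K J : X.IdealSheafData} {d : ℕ}
    (IH : ∀ e, d ≤ e → ∀ 𝓖 : ℕᵒᵖ ⥤ X.Modules, IsFormalTower (algebraMapΓ f a) 𝓖 →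
      (∀ n, Coh (𝓖.obj ⟨n⟩)) → (∀ n, IsKilledBy K (𝓖.obj ⟨n⟩)) →
      (∀ n, IsKilledBy (J ^ e) (𝓖.obj ⟨n⟩)) →
        ∃ G : X.Modules, Coh G ∧ Nonempty (𝓖 ≅ cmplTower (algebraMapΓ f a) G)) :
    ∀ e, d ≤ e → ∀ 𝓖 : ℕᵒᵖ ⥤ X.Modules, IsFormalTower (algebraMapΓ f a) 𝓖 →
      (∀ n, Coh (𝓖.obj ⟨n⟩)) → (∀ n, IsKilledBy K (𝓖.obj ⟨n⟩)) →
      (∀ n, IsKilledBy ((Scheme.IdealSheafData.ofIdealTop (Ideal.span {algebraMapΓ f a}) * J) ^ e)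
        (𝓖.obj ⟨n⟩)) →
        ∃ G : X.Modules, Coh G ∧ Nonempty (𝓖 ≅ cmplTower (algebraMapΓ f a) G) :=
  fun e he _ h𝓖 h𝓖c h𝓖K h𝓖J =>
    exists_coh_iso_cmplTower_of_isKilledBy_mul_pow f a (IH e he) h𝓖 h𝓖c h𝓖K h𝓖J

end Mixed

end Literature.AlgebraicGeometry.Morphisms

end
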